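import Summits.Ventures.Crystal3D.Theorems.StickyWulffConstantCoaxialWallLawPayerTwinCellTwoPlateRow
import Summits.Ventures.Crystal3D.Theorems.StickyWulffConstantCoaxialWallLawPayerTwinTwoPlate
import Summits.Ventures.Crystal3D.Theorems.StickyWulffConstantCoaxialWallLawPayerAssembly
import HarnessLib

/-!
# The twin rung of `stub_coaxialTwoSlabAdhesion` UNDER THE CENSUS ROW: constant `√6/s_F` (= `½` at `s_F = 2√6`)

HONEST FRAMING. Venture `Summits/Ventures/Crystal3D` (cell `crystal3d-full`), helper `--supports` the crux
`CoaxialWallLaw` (stmt-Ventures-19481, `route-Ventures-StickyWulffConstant`), REGISTERED line `WallLedgerF` (planner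
cf-p1), open stub `stub_coaxialTwoSlabAdhesion`.  Rung credit only; F-C1 not moved.  STEP-2 of DECISION (xxxiii)
(19481-p2 g6): the assembly of the two-plate twin cell under the row (`wordNet_twin_payers_ge_twoPlate_row`,
`…PayerTwinCellTwoPlateRow`) by the DEFICIT ledger `twoSlab_cross_le_of_deficit` (`…PayerAssembly`): the in-plane
flux `2·√6·sin θ` of both plates is paid out of the window's pooled deficiency at the census rate `s_F`.

* **`coaxialTwoSlabAdhesion_general_twin_row`** — every Σ3-twin co-axial pair, every filling, HYPOTHESIS the local
  row `LocalEndRow v1 s_F` for the pair's two plate systems in normal form (bottom frame with rising in-plane roots,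
  top frame with falling in-plane roots; `0 < s_F`): the stub's inequality with adhesion term
  `φ₁ + φ₂ − (√6/s_F)·√(1 − ⟪L e₃, e₃⟫²)`;
* **`coaxialTwoSlabAdhesion_general_twin_of_row`** — `s_F ≤ 2√6`: the stub's inequality VERBATIM at `½·sin θ`.

Inputs BY NAME: `KissingGap δ`, `KissingClassification δ` (tree theorems at computational grade) and the census row
(cf-p1 ROUTE §86(47); numerics of record HOME/cf-lit/fstep1/STEP1-RESULTS.md: chain-consistent v1 ≤ 3.40 < 2√6).
WHAT THIS IS NOT: not a proof of the row; not the translation classes; F-C1 not moved.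
-/

noncomputable section

namespace Summit.Ventures.Crystal3D.Theorems

open Summit.Ventures.Crystal3D Finset
open Literature.MathematicalPhysics.StatisticalMechanics (fccStacking barlowStacking IsHaggSeq
  contactDeficiency)
open scoped InnerProductSpace

open scoped Classical in
/-- **The twin rung under the census row, constant `√6/s_F`.**  See the module docstring. -/
theorem coaxialTwoSlabAdhesion_general_twin_row {δ : ℝ} (hg : KissingGap δ) (hc : KissingClassification δ)
    (A₁ : EuclideanSpace ℝ (Fin 3) ≃ₗᵢ[ℝ] EuclideanSpace ℝ (Fin 3)) (t₁ : EuclideanSpace ℝ (Fin 3))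
    (A₂ : EuclideanSpace ℝ (Fin 3) ≃ₗᵢ[ℝ] EuclideanSpace ℝ (Fin 3)) (t₂ : EuclideanSpace ℝ (Fin 3))
    (L : EuclideanSpace ℝ (Fin 3) ≃ₗᵢ[ℝ] EuclideanSpace ℝ (Fin 3)) (s₁ s₂ : EuclideanSpace ℝ (Fin 3))
    (σ σ' : ℤ → ℤ) (hσ : IsHaggSeq σ) (hσ' : IsHaggSeq σ')
    (hsub₁ : (fun p => A₁ p + t₁) '' fccStacking 1 (Real.sqrt (2 / 3)) ⊆
      (fun p => L p + s₁) '' barlowStacking 1 (Real.sqrt (2 / 3)) σ)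
    (hsub₂ : (fun p => A₂ p + t₂) '' fccStacking 1 (Real.sqrt (2 / 3)) ⊆
      (fun p => L p + s₂) '' barlowStacking 1 (Real.sqrt (2 / 3)) σ')
    (htwin : A₁ '' fccStacking 1 (Real.sqrt (2 / 3)) ≠ A₂ '' fccStacking 1 (Real.sqrt (2 / 3)))
    {sF : ℝ} (hsF : 0 < sF)
    (hrow : ∀ F : Bool → (EuclideanSpace ℝ (Fin 3) ≃ₗᵢ[ℝ] EuclideanSpace ℝ (Fin 3)),
      ((F false = L ∧ F true = (ℝ ∙ EuclideanSpace.single (2 : Fin 3) (1 : ℝ)).reflection.trans L) ∨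
        (F false = (ℝ ∙ EuclideanSpace.single (2 : Fin 3) (1 : ℝ)).reflection.trans L ∧ F true = L)) →
      LocalEndRow WordVersion.v1 sF ⟨F false, inPlaneRoots (F false) 1⟩ ⟨F true, inPlaneRoots (F true) (-1)⟩) :
    ∃ C R₀ : ℝ, 1 ≤ R₀ ∧ ∀ h : ℝ, 0 ≤ h → ∀ ρ : ℝ, R₀ ≤ ρ →
      ∀ X P₁ P₂ : Finset (EuclideanSpace ℝ (Fin 3)),
      (∀ p ∈ X, ∀ q ∈ X, p ≠ q → 1 ≤ dist p q) → P₁ ⊆ X → P₂ ⊆ X \ P₁ →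
      (∀ p ∈ X, -(2 * R₀) ≤ p 2 ∧ p 2 ≤ h + 2 * R₀ ∧ p 0 ^ 2 + p 1 ^ 2 ≤ ρ ^ 2) →
      (∀ p, p ∈ P₁ ↔ (p ∈ (fun q => A₁ q + t₁) '' fccStacking 1 (Real.sqrt (2 / 3)) ∧
        -(2 * R₀) ≤ p 2 ∧ p 2 ≤ -R₀ ∧ p 0 ^ 2 + p 1 ^ 2 ≤ ρ ^ 2)) →
      (∀ p, p ∈ P₂ ↔ (p ∈ (fun q => A₂ q + t₂) '' fccStacking 1 (Real.sqrt (2 / 3)) ∧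
        h + R₀ ≤ p 2 ∧ p 2 ≤ h + 2 * R₀ ∧ p 0 ^ 2 + p 1 ^ 2 ≤ ρ ^ 2)) →
      ((((P₁ ×ˢ (X \ P₁)).filter fun pq => dist pq.1 pq.2 = 1).card : ℕ) : ℝ) +
        ((((P₂ ×ˢ ((X \ P₁) \ P₂)).filter fun pq => dist pq.1 pq.2 = 1).card : ℕ) : ℝ) ≤
        contactDeficiency ((X \ P₁) \ P₂) +
          (Real.sqrt 2 / 4 * ∑ᶠ w ∈ {w ∈ fccStacking 1 (Real.sqrt (2 / 3)) | ‖w‖ = 1},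
              |⟪w, A₁.symm (EuclideanSpace.single (2 : Fin 3) (1 : ℝ))⟫_ℝ| +
            Real.sqrt 2 / 4 * ∑ᶠ w ∈ {w ∈ fccStacking 1 (Real.sqrt (2 / 3)) | ‖w‖ = 1},
              |⟪w, A₂.symm (EuclideanSpace.single (2 : Fin 3) (1 : ℝ))⟫_ℝ| -
            (Real.sqrt 6 / sF) * Real.sqrt (1 - ⟪L (EuclideanSpace.single (2 : Fin 3) (1 : ℝ)),
              (EuclideanSpace.single (2 : Fin 3) (1 : ℝ))⟫_ℝ ^ 2)) * Real.pi * ρ ^ 2 +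
          C * (1 + h) * ρ := by
  set e₃ : EuclideanSpace ℝ (Fin 3) := EuclideanSpace.single (2 : Fin 3) (1 : ℝ) with he₃
  set RL : EuclideanSpace ℝ (Fin 3) ≃ₗᵢ[ℝ] EuclideanSpace ℝ (Fin 3) :=
    (ℝ ∙ EuclideanSpace.single (2 : Fin 3) (1 : ℝ)).reflection.trans L with hRL
  -- the pair is a twin pair in the frame: `σ 0 ≠ σ' 0`
  have htw : σ 0 ≠ σ' 0 := by
    intro heq
    obtain ⟨-, e₁⟩ := linear_image_eq_frame_of_subset A₁ L t₁ s₁ hσ hsub₁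
    obtain ⟨-, e₂⟩ := linear_image_eq_frame_of_subset A₂ L t₂ s₂ hσ' hsub₂
    exact htwin (by rw [e₁, e₂, heq])
  -- normal form: the grains are `F false·Λ₀ + s₁`, `F true·Λ₀ + s₂` with `{F false, F true} = {L, L∘R}`
  have hnorm : ∃ F : Bool → (EuclideanSpace ℝ (Fin 3) ≃ₗᵢ[ℝ] EuclideanSpace ℝ (Fin 3)),
      ((F false = L ∧ F true = RL) ∨ (F false = RL ∧ F true = L)) ∧
      (fun q => A₁ q + t₁) '' fccStacking 1 (Real.sqrt (2 / 3)) =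
        (fun q => F false q + s₁) '' fccStacking 1 (Real.sqrt (2 / 3)) ∧
      (fun q => A₂ q + t₂) '' fccStacking 1 (Real.sqrt (2 / 3)) =
        (fun q => F true q + s₂) '' fccStacking 1 (Real.sqrt (2 / 3)) := by
    rcases hσ 0 with h1 | hm1
    · have hm1' : σ' 0 = -1 := (hσ' 0).resolve_left fun h' => htw (h1.trans h'.symm)
      have e₁ := coaxial_frame_eq_fcc_of_one A₁ t₁ L s₁ hσ hsub₁ h1
      obtain ⟨e₂, -⟩ := coaxial_frame_eq_fcc_of_neg_one A₂ t₂ L s₂ hσ' hsub₂ hm1'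
      exact ⟨fun c => cond c RL L, Or.inl ⟨rfl, rfl⟩, e₁, e₂⟩
    · have h1' : σ' 0 = 1 := (hσ' 0).resolve_right fun h' => htw (hm1.trans h'.symm)
      obtain ⟨e₁, -⟩ := coaxial_frame_eq_fcc_of_neg_one A₁ t₁ L s₁ hσ hsub₁ hm1
      have e₂ := coaxial_frame_eq_fcc_of_one A₂ t₂ L s₂ hσ' hsub₂ h1'
      exact ⟨fun c => cond c L RL, Or.inr ⟨rfl, rfl⟩, e₁, e₂⟩
  obtain ⟨F, hF, e₁, e₂⟩ := hnorm
  obtain ⟨n, hn⟩ : ∃ n : EuclideanSpace ℝ (Fin 3), n = L e₃ ∨ n = -L e₃ := ⟨L e₃, Or.inl rfl⟩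
  -- the three rising in-plane classes of the bottom frame carry `√3 sin θ`
  set s : ℝ := Real.sqrt (1 - ⟪L e₃, e₃⟫_ℝ ^ 2) with hs
  have hs0 : 0 ≤ s := Real.sqrt_nonneg _
  have h63 : Real.sqrt 6 * s ≤
      Real.sqrt 2 * ∑ r ∈ fccSlots.filter (fun r => ⟪F false r, n⟫_ℝ = 0 ∧ 0 < (F false r) 2), (F false r) 2 := by
    have key := sum_inPlane_rising_ge L F hF hn
    have e : Real.sqrt 6 = Real.sqrt 2 * Real.sqrt 3 := by
      rw [← Real.sqrt_mul (by norm_num : (0:ℝ) ≤ 2)]; norm_num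
    rw [e, mul_assoc]
    exact mul_le_mul_of_nonneg_left key (Real.sqrt_nonneg _)
  -- the deficit ledger and the constant
  set K : ℝ := 24 * (12 * Real.sqrt 2 * Real.pi + 36 * 10 + 55440) with hK
  have hK0 : 0 ≤ K := by positivity
  obtain ⟨C, hC⟩ := twoSlab_cross_le_of_deficit A₁ t₁ A₂ t₂ 10 le_rfl
  refine ⟨C + (K / sF) / 2, 10, by norm_num, ?_⟩
  intro h hh ρ hρ X P₁ P₂ hX hP₁X hP₂X₁ hcyl hP₁ hP₂
  have hP₂X : P₂ ⊆ X := hP₂X₁.trans sdiff_subset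
  have hρ0 : (0 : ℝ) ≤ ρ := by linarith
  have hP₁' := hP₁
  have hP₂' := hP₂
  simp only [e₁, e₂] at hP₁' hP₂'
  -- the cell under the row
  have hcellpay := wordNet_twin_payers_ge_twoPlate_row hg hc L F hF hn (hrow F hF) s₁ s₂ X P₁ P₂ 10 h ρ
    le_rfl hh hρ hX hcyl hP₁X hP₂X hP₁' hP₂'
  -- the window's pooled deficiency dominates the payers' part
  set W := X.filter (fun z => -(10 : ℝ) - 2 ≤ z 2 ∧ z 2 ≤ h + 10 + 2) with hW
  have hdef0 : ∀ z ∈ X, (0 : ℝ) ≤ 12 - ((X.filter fun q => dist z q = 1).card : ℝ) := by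
    intro z _
    have := card_filter_dist_eq_one_le_twelve X hX z
    have : ((X.filter fun q => dist z q = 1).card : ℝ) ≤ 12 := by exact_mod_cast this
    linarith
  have hPW : ∑ z ∈ X.filter (fun z => (X.filter fun q => dist z q = 1).card ≤ 11 ∧
        -(10 : ℝ) - 2 ≤ z 2 ∧ z 2 ≤ h + 10 + 2), ((12 : ℝ) - ((X.filter fun q => dist z q = 1).card : ℝ)) ≤
      ∑ z ∈ W, ((12 : ℝ) - ((X.filter fun q => dist z q = 1).card : ℝ)) :=
    sum_le_sum_of_subset_of_nonneg (fun z hz => by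
        obtain ⟨hzX, -, h1, h2⟩ := mem_filter.1 hz
        exact mem_filter.2 ⟨hzX, h1, h2⟩)
      fun z hz _ => hdef0 z (mem_filter.1 hz).1
  -- the hypothesis of the deficit ledger with `c = 2√6 s / sF`
  have hpay : (2 * Real.sqrt 6 * s / sF) * Real.pi * ρ ^ 2 - (K / sF) * (1 + h) * ρ ≤
      ∑ z ∈ W, ((12 : ℝ) - ((X.filter fun q => dist z q = 1).card : ℝ)) := by
    have hπρ : 0 ≤ Real.pi * ρ ^ 2 := by positivity
    have hflux' : 2 * (Real.sqrt 6 * s * Real.pi * ρ ^ 2) ≤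
        2 * (Real.sqrt 2 * (∑ r ∈ fccSlots.filter (fun r => ⟪F false r, n⟫_ℝ = 0 ∧ 0 < (F false r) 2), (F false r) 2) *
          Real.pi * ρ ^ 2) := by
      have := mul_le_mul_of_nonneg_right h63 hπρ
      nlinarith only [this]
    have hKh : K * ρ ≤ K * (1 + h) * ρ := by
      have := mul_nonneg (mul_nonneg hK0 hh) hρ0; linarith only [this]
    -- `2√6 s πρ² − K(1+h)ρ ≤ sF · Σ_W`
    have h1 : 2 * Real.sqrt 6 * s * Real.pi * ρ ^ 2 - K * (1 + h) * ρ ≤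
        sF * ∑ z ∈ W, ((12 : ℝ) - ((X.filter fun q => dist z q = 1).card : ℝ)) := by
      have hsW : sF * ∑ z ∈ X.filter (fun z => (X.filter fun q => dist z q = 1).card ≤ 11 ∧
            -(10 : ℝ) - 2 ≤ z 2 ∧ z 2 ≤ h + 10 + 2), ((12 : ℝ) - ((X.filter fun q => dist z q = 1).card : ℝ)) ≤
          sF * ∑ z ∈ W, ((12 : ℝ) - ((X.filter fun q => dist z q = 1).card : ℝ)) :=
        mul_le_mul_of_nonneg_left hPW hsF.le
      linarith only [hcellpay, hflux', hKh, hsW]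
    -- divide by `sF`
    have h2 : (2 * Real.sqrt 6 * s / sF) * Real.pi * ρ ^ 2 - (K / sF) * (1 + h) * ρ =
        (2 * Real.sqrt 6 * s * Real.pi * ρ ^ 2 - K * (1 + h) * ρ) / sF := by
      field_simp
    rw [h2, div_le_iff₀ hsF]
    linarith only [h1]
  have key := hC h hh ρ hρ X P₁ P₂ hX hP₁X hP₂X₁ hcyl hP₁ hP₂ (2 * Real.sqrt 6 * s / sF) (K / sF)
    (div_nonneg hK0 hsF.le) hpay
  have e : (2 * Real.sqrt 6 * s / sF) / 2 = Real.sqrt 6 / sF * s := by ring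
  rw [e] at key
  exact key

open scoped Classical in
/-- **The twin rung at `½·sin θ` from a certified row with `s_F ≤ 2√6`.**  See the module docstring. -/
theorem coaxialTwoSlabAdhesion_general_twin_of_row {δ : ℝ} (hg : KissingGap δ) (hc : KissingClassification δ)
    (A₁ : EuclideanSpace ℝ (Fin 3) ≃ₗᵢ[ℝ] EuclideanSpace ℝ (Fin 3)) (t₁ : EuclideanSpace ℝ (Fin 3))
    (A₂ : EuclideanSpace ℝ (Fin 3) ≃ₗᵢ[ℝ] EuclideanSpace ℝ (Fin 3)) (t₂ : EuclideanSpace ℝ (Fin 3))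
    (L : EuclideanSpace ℝ (Fin 3) ≃ₗᵢ[ℝ] EuclideanSpace ℝ (Fin 3)) (s₁ s₂ : EuclideanSpace ℝ (Fin 3))
    (σ σ' : ℤ → ℤ) (hσ : IsHaggSeq σ) (hσ' : IsHaggSeq σ')
    (hsub₁ : (fun p => A₁ p + t₁) '' fccStacking 1 (Real.sqrt (2 / 3)) ⊆
      (fun p => L p + s₁) '' barlowStacking 1 (Real.sqrt (2 / 3)) σ)
    (hsub₂ : (fun p => A₂ p + t₂) '' fccStacking 1 (Real.sqrt (2 / 3)) ⊆
      (fun p => L p + s₂) '' barlowStacking 1 (Real.sqrt (2 / 3)) σ')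
    (htwin : A₁ '' fccStacking 1 (Real.sqrt (2 / 3)) ≠ A₂ '' fccStacking 1 (Real.sqrt (2 / 3)))
    {sF : ℝ} (hsF : 0 < sF) (hsF' : sF ≤ 2 * Real.sqrt 6)
    (hrow : ∀ F : Bool → (EuclideanSpace ℝ (Fin 3) ≃ₗᵢ[ℝ] EuclideanSpace ℝ (Fin 3)),
      ((F false = L ∧ F true = (ℝ ∙ EuclideanSpace.single (2 : Fin 3) (1 : ℝ)).reflection.trans L) ∨
        (F false = (ℝ ∙ EuclideanSpace.single (2 : Fin 3) (1 : ℝ)).reflection.trans L ∧ F true = L)) →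
      LocalEndRow WordVersion.v1 sF ⟨F false, inPlaneRoots (F false) 1⟩ ⟨F true, inPlaneRoots (F true) (-1)⟩) :
    ∃ C R₀ : ℝ, 1 ≤ R₀ ∧ ∀ h : ℝ, 0 ≤ h → ∀ ρ : ℝ, R₀ ≤ ρ →
      ∀ X P₁ P₂ : Finset (EuclideanSpace ℝ (Fin 3)),
      (∀ p ∈ X, ∀ q ∈ X, p ≠ q → 1 ≤ dist p q) → P₁ ⊆ X → P₂ ⊆ X \ P₁ →
      (∀ p ∈ X, -(2 * R₀) ≤ p 2 ∧ p 2 ≤ h + 2 * R₀ ∧ p 0 ^ 2 + p 1 ^ 2 ≤ ρ ^ 2) →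
      (∀ p, p ∈ P₁ ↔ (p ∈ (fun q => A₁ q + t₁) '' fccStacking 1 (Real.sqrt (2 / 3)) ∧
        -(2 * R₀) ≤ p 2 ∧ p 2 ≤ -R₀ ∧ p 0 ^ 2 + p 1 ^ 2 ≤ ρ ^ 2)) →
      (∀ p, p ∈ P₂ ↔ (p ∈ (fun q => A₂ q + t₂) '' fccStacking 1 (Real.sqrt (2 / 3)) ∧
        h + R₀ ≤ p 2 ∧ p 2 ≤ h + 2 * R₀ ∧ p 0 ^ 2 + p 1 ^ 2 ≤ ρ ^ 2)) →
      ((((P₁ ×ˢ (X \ P₁)).filter fun pq => dist pq.1 pq.2 = 1).card : ℕ) : ℝ) +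
        ((((P₂ ×ˢ ((X \ P₁) \ P₂)).filter fun pq => dist pq.1 pq.2 = 1).card : ℕ) : ℝ) ≤
        contactDeficiency ((X \ P₁) \ P₂) +
          (Real.sqrt 2 / 4 * ∑ᶠ w ∈ {w ∈ fccStacking 1 (Real.sqrt (2 / 3)) | ‖w‖ = 1},
              |⟪w, A₁.symm (EuclideanSpace.single (2 : Fin 3) (1 : ℝ))⟫_ℝ| +
            Real.sqrt 2 / 4 * ∑ᶠ w ∈ {w ∈ fccStacking 1 (Real.sqrt (2 / 3)) | ‖w‖ = 1},
              |⟪w, A₂.symm (EuclideanSpace.single (2 : Fin 3) (1 : ℝ))⟫_ℝ| -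
            (1 / 2 : ℝ) * Real.sqrt (1 - ⟪L (EuclideanSpace.single (2 : Fin 3) (1 : ℝ)),
              (EuclideanSpace.single (2 : Fin 3) (1 : ℝ))⟫_ℝ ^ 2)) * Real.pi * ρ ^ 2 +
          C * (1 + h) * ρ := by
  set e₃ : EuclideanSpace ℝ (Fin 3) := EuclideanSpace.single (2 : Fin 3) (1 : ℝ) with he₃
  obtain ⟨C, R₀, hR₀, hmain⟩ := coaxialTwoSlabAdhesion_general_twin_row hg hc A₁ t₁ A₂ t₂ L s₁ s₂ σ σ' hσ hσ' hsub₁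
    hsub₂ htwin hsF hrow
  refine ⟨C, R₀, hR₀, ?_⟩
  intro h hh ρ hρ X P₁ P₂ hX hP₁X hP₂X₁ hcyl hP₁ hP₂
  have key := hmain h hh ρ hρ X P₁ P₂ hX hP₁X hP₂X₁ hcyl hP₁ hP₂
  have hs0 : 0 ≤ Real.sqrt (1 - ⟪L e₃, e₃⟫_ℝ ^ 2) := Real.sqrt_nonneg _
  have hc' : (1 / 2 : ℝ) * Real.sqrt (1 - ⟪L e₃, e₃⟫_ℝ ^ 2) ≤ Real.sqrt 6 / sF * Real.sqrt (1 - ⟪L e₃, e₃⟫_ℝ ^ 2) := by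
    refine mul_le_mul_of_nonneg_right ?_ hs0
    rw [le_div_iff₀ hsF]
    linarith only [hsF']
  have hπρ : 0 ≤ Real.pi * ρ ^ 2 := by positivity
  have := mul_le_mul_of_nonneg_right hc' hπρ
  linarith only [key, this]

end Summit.Ventures.Crystal3D.Theorems

end
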